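import Summits.FinalStateConjecture.FinalStateConjecture.Theses.PhotonSphereChannels
import Summits.FinalStateConjecture.FinalStateConjecture.Theorems.PhotonSphereChannelsWindowedShellChannelsOfZonePoly

/-!
# Crux `WindowedShellChannels` (stmt-FinalStateConjecture-14085) — line `parity-kernels`
# (crux-strategist s2: the DECOMPOSITION of the crux into the two parity halves of its landed kernel, as a skeleton)

This is NOT a new mechanism: it is the strategist's typed split `W ⇐ KernelEven ∧ KernelOdd` registered as an
alternative skeleton because `route edit --split` is final-cycle-gated for this seat.  The live lead line `Sketch`
(v11, lead c4) has ONE stub, `stub_zonePoly σ` (all real `σ`); here the two honest parities are separate NAMED stubs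
(`σ² ≠ 1` is vacuous: the parity clause forces `ψ ≡ 0`), so that workers / TTRL / disprovers can hold them separately —
they differ exactly where the only known obstruction lives (radiation-side forms `A − B` vs `A + B`; in the integer
inverse-square model one parity fails and the other holds, Côte–Kenig–Schlag 2014).  The composition is the landed
kernel reduction `windowedShellChannels_of_zonePoly` (p135139) through the strategist's glue (proved below, identical
to the crux evidence file `PhotonSphereChannelsWindowedShellChannelsSplit.lean`).  The new MECHANISM proposal for both
stubs is the crux idea `coulomb-phase-decoherence` (Ideas/), whose first lemma is typed in the strategist's
`Sketch-F3.lean`; it cannot be a skeleton yet (no 1-D scattering / distorted-Fourier vocabulary in the tree).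
Sorries ONLY in `stub_*`.
-/

noncomputable section

set_option linter.dupNamespace false

namespace Summit.FinalStateConjecture.FinalStateConjecture.Cruxes.WindowedShellChannels.ParityKernels

open Literature.Geometry.Lorentzian Literature.Geometry.Lorentzian.ReggeWheeler
open Summit.FinalStateConjecture.FinalStateConjecture.Theses.PhotonSphereChannels
open Summit.FinalStateConjecture.FinalStateConjecture.Theorems.WindowedShellChannelsSketch
open Filter Set MeasureTheory
open scoped ENNReal Topology

/-- STUB 1 — THE EVEN KERNEL (`= stub_zonePoly 1` of line `Sketch`; route child `WindowedShellKernelEven` once the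
split is filed).  Unit mass, centred tortoise line, `s ≤ 2`: for every shell half-width `ρ > 0` there are a lag `h ≥ 0`
and `c > 0` such that for every degree `k` there is `ℓ₀` beyond which every finite-energy time-EVEN Regge–Wheeler
solution (data `(ψ₀, 0)`) supported in `{ρ < |x|} ∩ [−(ℓ+2)^k, (ℓ+2)^k]` radiates `≥ c·E` ahead of the lagged forward
cone.  Radiation side: `caught⁺ = A − sB`.  Hardest input: the multi-scale sub-barrier band (benign zero-frequency
phase + Coulomb curvature `ωθ'' → 2M` against the KLLS scale-spread family) and the barrier-top band. -/
theorem stub_kernelEven : ∀ ρ : ℝ, 0 < ρ → ∃ h : ℝ, 0 ≤ h ∧ ∃ c : ℝ, 0 < c ∧ ∀ k : ℕ, ∃ ℓ₀ : ℕ,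
    ∀ (s ℓ : ℕ), s ≤ 2 → s ≤ ℓ → ℓ₀ ≤ ℓ → ∀ ψ : ℝ → ℝ → ℝ,
        IsRWSolution 1 s ℓ (tortoiseRadius one_pos 0) ψ → (∀ t x, ψ (-t) x = ψ t x) →
        CauchyDataSupportedOn ψ ({x : ℝ | ρ < |x|} ∩ Icc (-(((ℓ : ℝ) + 2) ^ k)) (((ℓ : ℝ) + 2) ^ k)) →
        totalEnergy (linePotential 1 s ℓ (tortoiseRadius one_pos 0)) ψ 0 ≠ ⊤ →
          ENNReal.ofReal c * totalEnergy (linePotential 1 s ℓ (tortoiseRadius one_pos 0)) ψ 0 ≤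
            channelEnergy (linePotential 1 s ℓ (tortoiseRadius one_pos 0)) 0 (ρ - h) ψ atTop := by
  sorry

/-- STUB 2 — THE ODD KERNEL (`= stub_zonePoly (-1)`; route child `WindowedShellKernelOdd`): the same for time-ODD
solutions (data `(0, ψ₁)`), radiation side `caught⁺ = A + sB` — the other sign of the Hilbert-type form, the one that
fails in the integer model for half of the dimensions. -/
theorem stub_kernelOdd : ∀ ρ : ℝ, 0 < ρ → ∃ h : ℝ, 0 ≤ h ∧ ∃ c : ℝ, 0 < c ∧ ∀ k : ℕ, ∃ ℓ₀ : ℕ,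
    ∀ (s ℓ : ℕ), s ≤ 2 → s ≤ ℓ → ℓ₀ ≤ ℓ → ∀ ψ : ℝ → ℝ → ℝ,
        IsRWSolution 1 s ℓ (tortoiseRadius one_pos 0) ψ → (∀ t x, ψ (-t) x = -ψ t x) →
        CauchyDataSupportedOn ψ ({x : ℝ | ρ < |x|} ∩ Icc (-(((ℓ : ℝ) + 2) ^ k)) (((ℓ : ℝ) + 2) ^ k)) →
        totalEnergy (linePotential 1 s ℓ (tortoiseRadius one_pos 0)) ψ 0 ≠ ⊤ →
          ENNReal.ofReal c * totalEnergy (linePotential 1 s ℓ (tortoiseRadius one_pos 0)) ψ 0 ≤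
            channelEnergy (linePotential 1 s ℓ (tortoiseRadius one_pos 0)) 0 (ρ - h) ψ atTop := by
  sorry

/-! ## Glue (proved): the two parities give the kernel for every real `σ`, hence the crux -/

/-- A function of time parity `σ` with `σ ≠ ±1` vanishes identically. [folklore] -/
theorem eq_zero_of_parity_ne {σ : ℝ} (hσ : σ ≠ 1) (hσ' : σ ≠ -1) {ψ : ℝ → ℝ → ℝ}
    (hpar : ∀ t x, ψ (-t) x = σ * ψ t x) : ψ = fun _ _ => 0 := by
  funext t x
  have ha : ψ (-t) x = σ * ψ t x := hpar t x
  have hb : ψ t x = σ * ψ (-t) x := by simpa only [neg_neg] using hpar (-t) x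
  have h2 : (1 - σ ^ 2) * ψ t x = 0 := by linear_combination hb + σ * ha
  have h3 : 1 - σ ^ 2 ≠ 0 := by
    intro h
    have : (σ - 1) * (σ + 1) = 0 := by linear_combination -h
    rcases mul_eq_zero.1 this with h4 | h4
    · exact hσ (by linarith)
    · exact hσ' (by linarith)
  exact (mul_eq_zero.1 h2).resolve_left h3

/-- The total energy of the zero solution vanishes. [folklore] -/
theorem totalEnergy_zero_fun (V : ℝ → ℝ) (t : ℝ) : totalEnergy V (fun _ _ => (0 : ℝ)) t = 0 := by
  unfold totalEnergy energyDensity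
  simp

/-- GLUE (proved; = `windowedShellChannels_of_subs` of the crux evidence file): even kernel → odd kernel → the kernel
for every real parity `σ`. -/
theorem kernel_all_of_even_odd
    (he : ∀ ρ : ℝ, 0 < ρ → ∃ h : ℝ, 0 ≤ h ∧ ∃ c : ℝ, 0 < c ∧ ∀ k : ℕ, ∃ ℓ₀ : ℕ,
      ∀ (s ℓ : ℕ), s ≤ 2 → s ≤ ℓ → ℓ₀ ≤ ℓ → ∀ ψ : ℝ → ℝ → ℝ,
        IsRWSolution 1 s ℓ (tortoiseRadius one_pos 0) ψ → (∀ t x, ψ (-t) x = ψ t x) →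
        CauchyDataSupportedOn ψ ({x : ℝ | ρ < |x|} ∩ Icc (-(((ℓ : ℝ) + 2) ^ k)) (((ℓ : ℝ) + 2) ^ k)) →
        totalEnergy (linePotential 1 s ℓ (tortoiseRadius one_pos 0)) ψ 0 ≠ ⊤ →
          ENNReal.ofReal c * totalEnergy (linePotential 1 s ℓ (tortoiseRadius one_pos 0)) ψ 0 ≤
            channelEnergy (linePotential 1 s ℓ (tortoiseRadius one_pos 0)) 0 (ρ - h) ψ atTop)
    (ho : ∀ ρ : ℝ, 0 < ρ → ∃ h : ℝ, 0 ≤ h ∧ ∃ c : ℝ, 0 < c ∧ ∀ k : ℕ, ∃ ℓ₀ : ℕ,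
      ∀ (s ℓ : ℕ), s ≤ 2 → s ≤ ℓ → ℓ₀ ≤ ℓ → ∀ ψ : ℝ → ℝ → ℝ,
        IsRWSolution 1 s ℓ (tortoiseRadius one_pos 0) ψ → (∀ t x, ψ (-t) x = -ψ t x) →
        CauchyDataSupportedOn ψ ({x : ℝ | ρ < |x|} ∩ Icc (-(((ℓ : ℝ) + 2) ^ k)) (((ℓ : ℝ) + 2) ^ k)) →
        totalEnergy (linePotential 1 s ℓ (tortoiseRadius one_pos 0)) ψ 0 ≠ ⊤ →
          ENNReal.ofReal c * totalEnergy (linePotential 1 s ℓ (tortoiseRadius one_pos 0)) ψ 0 ≤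
            channelEnergy (linePotential 1 s ℓ (tortoiseRadius one_pos 0)) 0 (ρ - h) ψ atTop) (σ : ℝ) :
    ∀ ρ : ℝ, 0 < ρ → ∃ h : ℝ, 0 ≤ h ∧ ∃ c : ℝ, 0 < c ∧ ∀ k : ℕ, ∃ ℓ₀ : ℕ,
      ∀ (s ℓ : ℕ), s ≤ 2 → s ≤ ℓ → ℓ₀ ≤ ℓ → ∀ ψ : ℝ → ℝ → ℝ,
        IsRWSolution 1 s ℓ (tortoiseRadius one_pos 0) ψ → (∀ t x, ψ (-t) x = σ * ψ t x) →
        CauchyDataSupportedOn ψ ({x : ℝ | ρ < |x|} ∩ Icc (-(((ℓ : ℝ) + 2) ^ k)) (((ℓ : ℝ) + 2) ^ k)) →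
        totalEnergy (linePotential 1 s ℓ (tortoiseRadius one_pos 0)) ψ 0 ≠ ⊤ →
          ENNReal.ofReal c * totalEnergy (linePotential 1 s ℓ (tortoiseRadius one_pos 0)) ψ 0 ≤
            channelEnergy (linePotential 1 s ℓ (tortoiseRadius one_pos 0)) 0 (ρ - h) ψ atTop := by
  by_cases h1 : σ = 1
  · subst h1
    intro ρ hρ
    obtain ⟨h, hh, c, hc, H⟩ := he ρ hρ
    refine ⟨h, hh, c, hc, fun k => ?_⟩
    obtain ⟨ℓ₀, Hk⟩ := H k
    exact ⟨ℓ₀, fun s ℓ hs hsℓ hℓ ψ hψ hpar hsupp hfin =>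
      Hk s ℓ hs hsℓ hℓ ψ hψ (fun t x => by rw [← one_mul (ψ t x)]; exact hpar t x) hsupp hfin⟩
  by_cases h2 : σ = -1
  · subst h2
    intro ρ hρ
    obtain ⟨h, hh, c, hc, H⟩ := ho ρ hρ
    refine ⟨h, hh, c, hc, fun k => ?_⟩
    obtain ⟨ℓ₀, Hk⟩ := H k
    exact ⟨ℓ₀, fun s ℓ hs hsℓ hℓ ψ hψ hpar hsupp hfin =>
      Hk s ℓ hs hsℓ hℓ ψ hψ (fun t x => by rw [← neg_one_mul (ψ t x)]; exact hpar t x) hsupp hfin⟩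
  intro ρ hρ
  refine ⟨0, le_rfl, 1, one_pos, fun k => ⟨0, fun s ℓ hs hsℓ hℓ ψ hψ hpar hsupp hfin => ?_⟩⟩
  have hz := eq_zero_of_parity_ne h1 h2 hpar
  subst hz
  rw [totalEnergy_zero_fun, mul_zero]
  exact bot_le

/-- **Line `parity-kernels` closes the crux modulo its two stubs**: `windowedShellChannels_of_zonePoly` (landed,
p135139) applied to the parity glue. -/
theorem WindowedShellChannels_of : WindowedShellChannels :=
  windowedShellChannels_of_zonePoly (kernel_all_of_even_odd stub_kernelEven stub_kernelOdd)

end Summit.FinalStateConjecture.FinalStateConjecture.Cruxes.WindowedShellChannels.ParityKernels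

end
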